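import Summits.ABC.IUTFork.Conditional.Layer5OfSV08
import Literature.IUT.HodgeTheaters.PiAvatarBaseKitOfTorsionMonodromy
import Literature.IUT.HodgeTheaters.PiAvatarLocalArrowLawL2Sign
import Literature.IUT.HodgeTheaters.PuncturedEllipticCoveringsCor12CarrowFromXarrow
import HarnessLib

/-!
# Layer-5 certificate, ADDITIVE PART v0.9 — the [IUTchI] §6 held rows Prop 6.5 (i), 6.6 (ii)(iii), 6.8 (i) AT THE GENUINE §6 BASE KIT of an
# initial Θ-datum (bank item (K): the D13 instance programme's kit `InitialThetaData.baseKitOfTorsionMonodromy`), `hβ` a THEOREM there;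
# and Cor 1.2 v5 with the orbicurve cusp-transport binder `hLem45C` ELIMINATED (abc-iut-L5-d4 g8, RULINGS #64 (1))
# (director-abc (C2); plan/L5/LAYER5-CERT-SPEC.md §7 «(K) hβ at baseKit» since v0.4; abc-iut-L5-lead gen 6 RULINGS #58 (2)(iv), #63, #65, #66; writer abc-iut-L5-d1 gen 6)

cert L5 v0.9 additive part (one module, PROOF-ONLY: no `def`, no `instance`, no `axiom`, no `sorry`, no `notation`; every input BY NAME; nothing of
v0–v0.8 (p430789, p430066, p431142, p433973, p435437, p437623, p439054, p442476, p445926, p447076) is touched).  TWO theorems, then the top `layer5_of_S_v9`: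

* (K) `layer5_held_sec6_v9_genuineKit` — v0's `layer5_held_sec6` (the four §6 held rows Prop 6.5 (i) [`InducesZeta` ∧ `XiGroupCompat`], 6.6 (ii), 6.6 (iii),
  6.8 (i), KIT-RELATIVE over an INTERFACE DATA ATOM `K : PMBaseKit l` with ONE law `hβ : Ex63.NegCompatModel K`) RE-GROUNDED AT THE GENUINE KIT
  `K := D.baseKitOfTorsionMonodromy CG hS M hA hI B hsign ΛBad` of an initial Θ-datum `D` over number fields (abc-iut-L5-t4 `PiAvatarBaseKitOfTorsionMonodromy`
  p446463 over `InitialThetaData.baseKit` p445979 — the D13 instance programme: abc-iut-L5-t4 PiAvatar*, abc-iut-L5-t2 `InitialThetaData`, abc-iut-L5-t8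
  `TorsionMonodromy`, abc-iut-L5-t13 (β)-engine, abc-iut-L5-t1 `CuspGalois`/`ArrowCoveringClaims`, abc-iut-L5-d5 (L1) p445209 / (L2) p446471).  There
  `hβ` is the THEOREM `negCompatModel_baseKitOfTorsionMonodromy` ((α) `PhiEllSync` likewise), and the good-place sign law `hsign` is SUPPLIED by
  abc-iut-L5-d5's theorem `localArrowLaw_L2_sign_local CG hS hA (D.decompAt v)` (from the printed §1 claims by ramification); `l ≠ 2` is the datum's
  Def 3.1 (c).  BINDERS (t4's minimal list minus `hsign`): DATA `D` (initial Θ-datum), `CG` (cusp/Galois interface), `M : D.TorsionMonodromy` (NV #45),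
  `B` (bad-pair data); LAWS `hS` (`CuspClassesNormaliserStable`, G-L5t4g3-3) · `hA` (t1's typed §1 claims) · `hI` ((rel)-type law «cusp inertia of `ε′`
  is `τ`-invisible», G-L5d5g6-1; NV [degenerate] abc-iut-w4-d077) · `ΛBad` (local arrow laws at the BAD places).  Closers BY NAME:
  `DThetaEllBridge.inducesZeta` / `xiGroupCompat_of_negCompatModel` (abc-iut-L5-t13) and t4's `isoTorsor_thetaEllBridge_/isoTorsor_thetaPMEllHT_/
  ellBridgeSymmetry_baseKitOfTorsionMonodromy`.  Conjuncts = the SAME four typed node statements as v0, at the genuine kit.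
* (C5) `layer5_held_cor12_v5` — Cor 1.2 at the genuine `K`-level data with the ORBICURVE binder `hLem45C` ELIMINATED (abc-iut-L5-d4 g8
  `InitialThetaData.pe_characteristicNatureOfCoverings_viaX`, `PuncturedEllipticCoveringsCor12CarrowFromXarrow` p447384: the `C̲→`-case is reduced to the
  `X̲→`-case inside the closer by the index count `[Π_{C̲→} : Π_{X̲→}] = 2`), in favour of ONE classical-shaped law `hι'` at the primed datum only («`ι` acts on
  `Δ_E ⊗ ℤ/l` via `−1`», p.37–38).  LAW 13 (`h h' h0 h0' hΔ hΔ' htf huniq' hext hextC hA hA' hι'`): same count as v0.7's `cor12_v4`, strictly more primitive;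
  most-reduced Cor 1.2 count unchanged (v0's abstract form).

CENSUS v0.9 (BINDER CONVENTION of RULINGS #40 (1); HEADLINE RULE of RULINGS #61 as BOOKED for §6 by RULINGS #69: the genuine kit IS print's §6 base
datum of Def 6.1 at the initial Θ-data, so the genuine-kit form is the HEADLINE): **§6 laws = 4 {hS, hA, hI, ΛBad}** (hβ and hsign THEOREMS, `l ≠ 2` from
`five_le_l`) **[§6: 1 law hβ over the interface atom `K : PMBaseKit` — v0 form]**; hence most-reduced **CONE 34 → 37 (+2 record-laws in `P`) · FACT 0 · side 15 ·
NV 3** — booked in the HONEST direction: «the interface atom K hid three named laws; no mathematical content was added or removed».  Side convention: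
`[Fact l.Prime]` is the datum's own field `l_prime` and `hl` is derived, so neither is counted (side stays 15).  DATA `D CG M B` are data, not laws.  NV column
(names only; the NV count moves when these land/are folded): `hI` NV-witnessed [model; degenerate at the inertia] by abc-iut-L5-t8's p447268
`exists_initialThetaData_torsionMonodromy_tau_inertia`; `B` = abc-iut-L5-t4's «BadPairAt-NV» p447892 (`nonempty_badPairAt`, profinite decomposition
stand-in; pending); `ΛBad` = abc-iut-L5-d5's (N1) (GO, RULINGS #67); the SET {M, hA, hI} at ONE datum = abc-iut-w4-d077's «JOINT-NV regeom₂» (RULINGS #68,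
in flight).  Cor 1.2: (C5) 13 laws = v0.7's cor12_v4 13 with `hLem45C` ↦ `hι'` (delta 0; `hι'` groundable on abc-iut-L5-t1's `ModLCuspLaws.iota_neg` via
d4's sequel `…Cor12IotaLawOfLaws.lean`); most-reduced Cor 1.2 count unchanged (v0's abstract form).  Nodes 139 unchanged.  S-FREE.  Post-freeze-additive modules imported for the closers (not cone members): PiAvatarBaseKitOfTorsionMonodromy
(p446463, DEF-BEARING: the def `baseKitOfTorsionMonodromy` + laws, abc-iut-L5-t4; used through its theorems and as the kit TERM) and PiAvatarLocalArrowLawL2Sign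
(p446471, proof-only, abc-iut-L5-d5), PuncturedEllipticCoveringsCor12CarrowFromXarrow (p447384, proof-only, abc-iut-L5-d4 g8).

Mochizuki, *Inter-universal Teichmüller theory I: construction of Hodge theaters*, kurims manuscript (May 2020) [cite: Mochizuki2012]
(D-0012 claim key; series status DISPUTED).  HONEST FRAMING: nothing in this file asserts that abc is proved or refuted or takes a side on
[IUTchIII] Cor. 3.12 (nor on [IUTchI]); every binder is an ASSUMPTION LABEL, not an endorsement; the conjuncts are CLOSED statements obtained by applying
LANDED closers BY NAME at a CONSTRUCTED term; `M`, `B`, `CG` are DATA whose existence for a given curve is not asserted here (NV register #45 et al.);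
typed ≠ inhabited ≠ discharged; indexed ≠ endorsed; establishment = OUR kernel check only.  Later versions only REMOVE / SPLIT / RE-GROUND binders,
SPECIALISE a free datum parameter to print's value, or ADD coverage under named binders.
-/

namespace Summit.ABC.IUTFork.Conditional

open CategoryTheory Literature.IUT.HodgeTheaters ProfiniteGrp ProfiniteGrp.ProfiniteCompletion
open scoped Pointwise
universe u v w u'

section Sec6V9

/-! ## §6 held rows Prop 6.5 (i), 6.6 (ii)(iii), 6.8 (i) AT THE GENUINE KIT of an initial Θ-datum — `hβ` a THEOREM; binders = t4's minimal list -/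

/-- **Class (c), [IUTchI] §6 — HELD rows Prop 6.5 (i), 6.6 (ii), 6.6 (iii), 6.8 (i) AT THE GENUINE §6 BASE KIT of an initial Θ-datum `D`**
(v0's `layer5_held_sec6` took an INTERFACE DATA ATOM `K : PMBaseKit l` and ONE law `hβ : Ex63.NegCompatModel K`; bank item (K) of abc-iut-L5-lead
gen 5/6).  Here `K := D.baseKitOfTorsionMonodromy CG hS M hA hI B
      (fun v _ => D.localArrowLaw_L2_sign_local CG hS hA (D.decompAt v)) ΛBad` — abc-iut-L5-t4's GENUINE kit (`PiAvatarBaseKitOfTorsionMonodromy`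
p446463 over `InitialThetaData.baseKit` p445979, the D13 instance programme: abc-iut-L5-t4 PiAvatar*, abc-iut-L5-t8 `TorsionMonodromy`, abc-iut-L5-t13
(β)-engine, abc-iut-L5-d5 (L1) p445209, abc-iut-L5-t1 `CuspGalois`/`ArrowCoveringClaims`) — and `hβ` is the THEOREM
`negCompatModel_baseKitOfTorsionMonodromy` ((α) `PhiEllSync` likewise), and the good-place SIGN law (L2) is SUPPLIED by abc-iut-L5-d5's THEOREM
`localArrowLaw_L2_sign_local CG hS hA (D.decompAt v)` (p446471, from the printed §1 claims `hA` alone by ramification) — `hsign :=` that theorem.  BINDERS, exhaustively (t4's minimal list, per place-CLASS): DATA `D` (the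
initial Θ-datum over number fields, abc-iut-L5-t2), `CG` (cusp/Galois interface, t1), `M : D.TorsionMonodromy` (torsion monodromy datum, t8; NV #45),
`B` (bad-pair data at the bad indices, G-L5t4g3-2 (iii)); LAWS `hS` (`CuspClassesNormaliserStable`, G-L5t4g3-3) · `hA` (t1's typed §1 claims
`ArrowCoveringClaims`, standing) · `hI` (the (rel)-type classical law «cusp inertia of `ε′` is `τ`-invisible», G-L5d5g6-1; NV-witnessed
[degenerate] by abc-iut-w4-d077) · `ΛBad` (local arrow law at the BAD places; the bad pair itself is DATA `B`); NO `hsign` ((L1) p445209 and (L2) p446471 are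
d5's THEOREMS at every good place); `l ≠ 2` from the datum's
Def 3.1 (c) field `five_le_l` (no side binder; `[Fact l.Prime]` is the datum's `l_prime`).  Closers BY NAME: `DThetaEllBridge.inducesZeta` (unconditional) / `xiGroupCompat_of_negCompatModel` (abc-iut-L5-t13 p420660) and
t4's `isoTorsor_thetaEllBridge_/isoTorsor_thetaPMEllHT_/ellBridgeSymmetry_baseKitOfTorsionMonodromy`.  Conjuncts = the SAME four typed node statements
as v0's `layer5_held_sec6`, now at the genuine kit.  Census (RULINGS #69): THIS genuine-kit form is the §6 HEADLINE — 4 named laws `hS hA hI ΛBad` (none an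
[IUTchI] node statement) + 4 data `D CG M B`; v0's kit-relative form «1 law `hβ` over the interface atom `K`» goes to brackets («the interface atom K hid three
named laws; no mathematical content was added or removed»).  NV by name: `hI` [degenerate] abc-iut-L5-t8 p447268; `B` abc-iut-L5-t4 p447892 (pending); `ΛBad`
abc-iut-L5-d5 (N1); the set {M, hA, hI} jointly = abc-iut-w4-d077 «JOINT-NV regeom₂» (in flight).  Nothing here asserts that abc is proved or refuted or takes a side on
[IUTchIII] Cor. 3.12; a binder is an assumption label; typed ≠ inhabited ≠ discharged. -/
theorem layer5_held_sec6_v9_genuineKit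
    {F : Type u} {K : Type v} {Fbar : Type w} [Field F] [NumberField F] [Field K] [NumberField K]
    [Algebra F K] [Field Fbar] [Algebra F Fbar] [Algebra K Fbar]
    {E : WeierstrassCurve F} [E.IsElliptic] {l : ℕ} {Pb : BadPlacePredicates K}
    (D : InitialThetaData F K Fbar E l Pb) [Fact l.Prime]
    -- DATA: cusp/Galois interface, torsion monodromy, bad-pair data
    (CG : D.geom.pe.CuspGalois) (M : D.TorsionMonodromy) (B : ∀ v, v ∈ D.indexCopyBad → D.BadPairAt v)
    -- LAWS: cusp-class normaliser stability, t1's §1 claims, the (rel)-type law, the bad-place local arrow laws ((L1)/(L2) at good places = d5's theorems)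
    (hS : D.CuspClassesNormaliserStable) (hA : D.geom.pe.ArrowCoveringClaims)
    (hI : ∀ k ∈ D.geom.pe.inertia D.geom.pe.ε1, M.tau (D.geom.embK k) = 0)
    (ΛBad : ∀ v (h : v ∈ D.indexCopyBad), D.LocalArrowLaw CG hS (B v h).H) :
    ((∀ Bθ : (D.baseKitOfTorsionMonodromy CG hS M hA hI B
        (fun v _ => D.localArrowLaw_L2_sign_local CG hS hA (D.decompAt v)) ΛBad).DThetaEllBridge, Bθ.InducesZeta) ∧
      ∀ Bθ : (D.baseKitOfTorsionMonodromy CG hS M hA hI B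
        (fun v _ => D.localArrowLaw_L2_sign_local CG hS hA (D.decompAt v)) ΛBad).DThetaEllBridge, Bθ.XiGroupCompat) ∧  -- IUTchI:Prop6.5(i)
    (∀ B₁ B₂ : (D.baseKitOfTorsionMonodromy CG hS M hA hI B
        (fun v _ => D.localArrowLaw_L2_sign_local CG hS hA (D.decompAt v)) ΛBad).DThetaEllBridge,
      PMBaseKit.DThetaEllBridge.IsoTorsor B₁ B₂) ∧  -- IUTchI:Prop6.6(ii)
    (∀ H₁ H₂ : (D.baseKitOfTorsionMonodromy CG hS M hA hI B
        (fun v _ => D.localArrowLaw_L2_sign_local CG hS hA (D.decompAt v)) ΛBad).DThetaPMEllHT,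
      PMBaseKit.DThetaPMEllHT.IsoTorsor H₁ H₂) ∧  -- IUTchI:Prop6.6(iii)
    (∀ H : (D.baseKitOfTorsionMonodromy CG hS M hA hI B
        (fun v _ => D.localArrowLaw_L2_sign_local CG hS hA (D.decompAt v)) ΛBad).DThetaPMEllHT,
      PMBaseKit.DThetaPMEllHT.EllBridgeSymmetry H) :=  -- IUTchI:Prop6.8(i)
  ⟨⟨fun Bθ => PMBaseKit.DThetaEllBridge.inducesZeta Bθ,
    fun Bθ => PMBaseKit.DThetaEllBridge.xiGroupCompat_of_negCompatModel (by have := D.five_le_l; omega)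
      (D.negCompatModel_baseKitOfTorsionMonodromy CG hS M hA hI B
      (fun v _ => D.localArrowLaw_L2_sign_local CG hS hA (D.decompAt v)) ΛBad) Bθ⟩,
   D.isoTorsor_thetaEllBridge_baseKitOfTorsionMonodromy CG hS M hA hI B
      (fun v _ => D.localArrowLaw_L2_sign_local CG hS hA (D.decompAt v)) ΛBad,
   D.isoTorsor_thetaPMEllHT_baseKitOfTorsionMonodromy CG hS M hA hI B
      (fun v _ => D.localArrowLaw_L2_sign_local CG hS hA (D.decompAt v)) ΛBad,
   D.ellBridgeSymmetry_baseKitOfTorsionMonodromy CG hS M hA hI B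
      (fun v _ => D.localArrowLaw_L2_sign_local CG hS hA (D.decompAt v)) ΛBad⟩

end Sec6V9

section Cor12V5

open Literature.AnabelianGeometry.AbsoluteAnabelian
open Literature.AnabelianGeometry.AbsoluteAnabelian.FundamentalExtension (CuspidalAlgorithm)
open Literature.AnabelianGeometry.AbsoluteAnabelian.AbsTopII (semiEllipticDoubleCoverSubgroups)

/-! ## Cor 1.2 at the GENUINE K-level datum, v5: the orbicurve binder `hLem45C` ELIMINATED (reduction to the `X̲→` case), ONE classical law `hι'` -/

/-- **Class (c), [IUTchI] §1 — HELD row Cor 1.2 at the GENUINE K-level datum, v5: the ORBICURVE cusp-transport binder `hLem45C` ELIMINATED** (bank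
item of abc-iut-L5-lead gen 6 RULINGS #64 (1); closer abc-iut-L5-d4 g8's `InitialThetaData.pe_characteristicNatureOfCoverings_viaX`,
`PuncturedEllipticCoveringsCor12CarrowFromXarrow.lean` p447384, over `InitialThetaDataNFBase` p443323 / `…Cor12Lem45` p442282 / `…Cor12GeomTFG` p441649).
Versus v0.7's `layer5_held_cor12_v4` (13 laws incl. `hLem45C` = [AbsTopI] Lem 4.5 + Rmk 1.2.2 (ii) cusp transport for the ORBICURVE `C̲`, for whose cusps the
frozen record has no carrier): the `C̲→`-isomorphism is reduced to the `X̲→`-case INSIDE the closer (`Π_{X̲→} = Π_{C̲→} ∩ Π_X` up to the index count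
`[Π_{C̲→} : Π_{X̲→}] = 2`, d4's `ofCarrow_viaX`), so `hLem45C` DISAPPEARS in favour of ONE classical-shaped law at the primed datum only: `hι'` — «`ι` acts on
`Δ_E ⊗ ℤ/l` via `−1`» (p.37 last line – p.38 l.1) in the form «an element of `Δ'_C̲ ∖ Δ'_X̲` does not centralise `Δ'_X^{ab} ⊗ 𝔽_l`» (an étale-`π₁` property
of the once-punctured elliptic curve; abc-iut-L5-t1's `ModLCuspLaws` (L3) `iota_neg` is its source law, bridge pending).  The rest as v0.7: `h h'` (printed
claims p.38), `C C'` (DATA), `h0 h0'` (G-L5d4g6-1), `hΔ hΔ'` ([AbsTopI] Prop 2.2 `GeomTFG`, F-0240; base data CONSTRUCTED `peNFBase`), `htf`/`huniq'`,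
`hext`/`hextC` (pure [AbsTopII] Cor 3.3 (i)), ONE cuspidal algorithm `A` (DATA) with `RecoversCusps` ×2 ([AbsTopI] Lem 4.5 (v), F-0206); `K K' F̄ F̄'` in
universe `0`.  LAW 13 (`h h' h0 h0' hΔ hΔ' htf huniq' hext hextC hA hA' hι'`) — same count as v4, but `hLem45C` (a pair-level orbicurve transport law) ↦
`hι'` (a primitive property of ONE datum); the most-reduced Cor 1.2 count stays with v0's abstract form.  Nothing here asserts that abc is proved or
refuted or takes a side on [IUTchIII] Cor. 3.12; a binder is an assumption label; typed ≠ discharged. -/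
theorem layer5_held_cor12_v5
    {F : Type u} {K : Type} {Fbar : Type} [Field F] [NumberField F] [Field K] [NumberField K]
    [Algebra F K] [Field Fbar] [Algebra F Fbar] [Algebra K Fbar]
    {E : WeierstrassCurve F} [E.IsElliptic] {l : ℕ} {Pb : BadPlacePredicates K}
    (D : InitialThetaData F K Fbar E l Pb)
    {F' : Type u'} {K' : Type} [Field F'] [NumberField F'] [Field K'] [NumberField K'] [Algebra F' K']
    {Fbar' : Type} [Field Fbar'] [Algebra F' Fbar'] [Algebra K' Fbar']
    {E' : WeierstrassCurve F'} [E'.IsElliptic] {l' : ℕ} {Pb' : BadPlacePredicates K'}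
    (D' : InitialThetaData F' K' Fbar' E' l' Pb')
    -- LAW: the printed claims of p.38 for both data ([IUTchI] §1 pp.37–38)
    (h : D.geom.pe.ArrowCoveringClaims) (h' : D'.geom.pe.ArrowCoveringClaims)
    -- DATA: cusp interfaces (abc-iut-L5-t1 `CuspGalois`)
    (C : D.geom.pe.CuspGalois) (C' : D'.geom.pe.CuspGalois)
    -- LAW: the printed ramification of `ε⁰` in `X̲→ → X̲` (GAP-LEDGER G-L5d4g6-1), both data
    (h0 : ¬ D.geom.pe.inertia D.geom.pe.ε0 ≤ D.geom.pe.piXarrow)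
    (h0' : ¬ D'.geom.pe.inertia D'.geom.pe.ε0 ≤ D'.geom.pe.piXarrow)
    -- LAW (L4 node BY NAME): [AbsTopI] Prop 2.2 `GeomTFG` at both cores (F-0240)
    (hΔ : D.geom.pe.E.GeomTFG) (hΔ' : D'.geom.pe.E.GeomTFG)
    -- LAW ([AbsTopII] Cor 3.3 (ii) side conditions): `Δ_X = Π_X ∩ Δ_C` torsion-free (`X` a scheme); uniqueness of the semi-elliptic double cover
    (htf : IsMulTorsionFree ↥(D.geom.pe.PiX ⊓ D.geom.pe.DeltaC))
    (huniq' : ∀ J ∈ semiEllipticDoubleCoverSubgroups D'.geom.pe.E,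
      J ⊓ D'.geom.pe.DeltaC = D'.geom.pe.PiX ⊓ D'.geom.pe.DeltaC)
    -- LAW ([AbsTopII] Cor 3.3 (i), pure extension form): every bicontinuous iso of `Π_{X̲→}`'s, resp. `Π_{C̲→}`'s, EXTENDS to the cores
    (hext : ∀ φ : D.geom.pe.piXarrow ≃* D'.geom.pe.piXarrow, Continuous φ → Continuous φ.symm →
      ∃ Θ : D.geom.pe.PiC ≃ₜ* D'.geom.pe.PiC,
        ∀ x : D.geom.pe.piXarrow, Θ (x : D.geom.pe.PiC) = (φ x : D'.geom.pe.PiC))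
    (hextC : ∀ ψ : D.geom.pe.piCarrow ≃* D'.geom.pe.piCarrow, Continuous ψ → Continuous ψ.symm →
      ∃ Θ : D.geom.pe.PiC ≃ₜ* D'.geom.pe.PiC,
        ∀ x : D.geom.pe.piCarrow, Θ (x : D.geom.pe.PiC) = (ψ x : D'.geom.pe.PiC))
    -- DATA + LAW (L4 node BY NAME): ONE group-theoretic cuspidal algorithm recovering the cusps of `X̲_K` and of `X̲_{K'}` ([AbsTopI] Lem 4.5 (v), F-0206)
    (A : CuspidalAlgorithm.{0}) (hA : A.RecoversCusps D.geom.pe.extXbar C.cuspidalDataXbar)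
    (hA' : A.RecoversCusps D'.geom.pe.extXbar C'.cuspidalDataXbar)
    -- LAW (classical-shaped, primed datum only): `ι` acts on `Δ'_X^{ab} ⊗ ℤ/l` by `−1` — an element of `Δ'_C̲ ∖ Δ'_X̲` does not centralise it
    (hι' : ∀ c ∈ D'.geom.pe.DeltaCbar, c ∉ D'.geom.pe.DeltaXbar →
      ∃ v ∈ D'.geom.pe.PiX ⊓ D'.geom.pe.DeltaC,
        c * v * c⁻¹ * v⁻¹ ∉ (⁅D'.geom.pe.PiX ⊓ D'.geom.pe.DeltaC, D'.geom.pe.PiX ⊓ D'.geom.pe.DeltaC⁆ ⊔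
          Subgroup.closure ((fun y : D'.geom.pe.PiC => y ^ D'.geom.pe.l) ''
            (D'.geom.pe.PiX ⊓ D'.geom.pe.DeltaC : Set D'.geom.pe.PiC))).topologicalClosure) :
    D.geom.pe.CharacteristicNatureOfCoverings D'.geom.pe :=  -- IUTchI:Cor1.2 at the genuine K-level data; hLem45C eliminated (via X̲)
  D.pe_characteristicNatureOfCoverings_viaX D' h h' C C' h0 h0' hΔ hΔ' htf huniq' hext hextC A hA hA' hι'

end Cor12V5

/-- **THE LAYER-5 CERTIFICATE v9 — SINGLE TOP OF RECORD**: the conjunction, BY NAME via `StatementOf`, of the v8 top `layer5_of_S_v8`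
(`Conditional/Layer5OfSV08.lean`, p447076; through it v7 … v0 and the companion) and this module's `layer5_held_sec6_v9_genuineKit` (the four §6 held rows at
the genuine kit of an initial Θ-datum, `hβ` a theorem) and `layer5_held_cor12_v5` (Cor 1.2 with the orbicurve binder `hLem45C` eliminated).  CENSUS v9 (RULINGS #69 booking): §6 = 4 at the genuine kit [1 kit-relative, v0]; most-reduced CONE 37 (+2 record-laws
in `P`) · FACT 0 · side 15 · NV 3 — «the interface atom K hid three named laws; no mathematical content was added or removed».  S-FREE.  Nothing here asserts that abc is proved or refuted or takes a side on [IUTchIII] Cor. 3.12; a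
binder is an assumption label; typed ≠ discharged; indexed ≠ endorsed. -/
theorem layer5_of_S_v9 :
    Summit.ABC.IUTFork.DAG.PartL5a.StatementOf @layer5_of_S_v8 ∧
    Summit.ABC.IUTFork.DAG.PartL5a.StatementOf @layer5_held_sec6_v9_genuineKit ∧
    Summit.ABC.IUTFork.DAG.PartL5a.StatementOf @layer5_held_cor12_v5 :=
  ⟨@layer5_of_S_v8, @layer5_held_sec6_v9_genuineKit, @layer5_held_cor12_v5⟩

end Summit.ABC.IUTFork.Conditional

/-! ### Build-lane export guard (ops-buildfix bf1-g30, 2026-08-28; G11b-3 recipe v2 as in `GelbartRogawski1991/UnitaryDualPairSeesawCharacter`):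
the theorems of this file carry very large dependent telescopes; at `.olean` export Lean 4.32's library-suggestion indexers fold over
every local theorem statement and do not finish within the build lane's one-hour clock (measured on a farm node: `lean -o` > 1 500 s, plain
elaboration ≈ 20 s). ONE file-final `local` `[implicit_reducible]` keeps them out of that premise index (inert for Meta and the kernel on
theorems; no definition is tagged; statements and proofs unchanged). -/
set_option allowUnsafeReducibility true in
attribute [local implicit_reducible]
  _root_.Summit.ABC.IUTFork.Conditional.layer5_held_sec6_v9_genuineKit
  _root_.Summit.ABC.IUTFork.Conditional.layer5_held_cor12_v5 _root_.Summit.ABC.IUTFork.Conditional.layer5_of_S_v9
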